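import Mathlib
import Summits.KontsevichZagierPeriods.KontsevichZagierPeriods.Theorems.SoloInformedLegendreKernel
import HarnessLib
import HarnessLib.Audit

/-!
# Kummer family IV: the hyperbolic reciprocity law for the third kind, I — the certificate (s41)

THEOREM XXVIII(a) of the residency paper (§6quattuordecies): for a real algebraic squared modulus
`0 < m < 1` and a pole parameter `0 < n < m` (the HYPERBOLIC band of the Kummer family) the
complete elliptic integral of the third kind `Π(n|m) = ∫₀¹ dx/((1−nx²)√((1−x²)(1−mx²)))`
satisfies, in the formal period ring `P` of the Kontsevich–Zagier calculus,

  `⟦[pt, w(σ)/σ]⟧·(⟦Π_n⟧ − ⟦K⟧) = ⟦K⟧·⟦E♯_σ⟧ − ⟦E⟧·⟦F♯_σ⟧`,  `n = mσ²`, `w(σ) = √((1−σ²)(1−mσ²))`,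

(`F♯_σ = [(0,σ), κ]`, `E♯_σ = [(0,σ), e]` the incomplete integrals at amplitude `sin ε = σ`;
in values `Π(n|m) = K + δ₁·(K E(ε|m) − E F(ε|m))`, `δ₁ = σ/w(σ)`: Abramowitz–Stegun 17.7.6, the
`π`-free real form of the reciprocity law between differentials of the first/second and the third
kind).  This file is the pointwise CERTIFICATE, in the coordinates `(x, t)`, `t = √(n/m)`, found in
s41, in which the law has NO singularity at the cusp `n = 0`: with
`κ(z) = (√(1−z²))⁻¹(√(1−mz²))⁻¹`, `W(z) = (1−z²)(1−mz²)` and the POTENTIAL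

  `Φ(a,b) = m a² κ(a) · (b W(b)/(1 − m a² b²)) · κ(b)`   (`= m a² b κ(a) √W(b)/(1 − m a² b²)`),

one has `∂_b Φ(a,b) = R(a,b) κ(a) κ(b)` with `R` RATIONAL (`soloInformedKummerZetaR`), and the
rational identity `R(x,t) − R(t,x) = m(x² − t²)` (`soloInformed_kummerZeta_rational_identity`),
i.e.

  `∂_t Φ(x,t) − ∂_x Φ(t,x) = κ(x)e(t) − e(x)κ(t)`   (`e(z) = (1 − mz²)κ(z)`),

the in-calculus Gauss–Manin derivative of `ξ_n = dx/((1−nx²)y)` along the family.  Since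
`Φ(x,0) = 0`, `Φ(t,0) = Φ(t,1) = 0` and `Φ(x,σ) = (w(σ)/σ)·(p_n − κ)(x)`, one Newton–Leibniz move in
`t` over the closed band `[0,σ]`, one kill of `∂_x Φ(t,x)` along the fibres and two Fubini products
give the law (files II–III).  Also here: continuity of `Φ(a,·)` on `[0,1]`, and the domination
`|R κ κ| ≤ 6(1−m)⁻³ (√(1−a))⁻¹(√(1−b))⁻¹`.

References: M. Abramowitz, I. Stegun, *Handbook of Mathematical Functions*, §17.7 (17.7.6);
M. Kontsevich, D. Zagier, *Periods* (2001), §1.2; this work (solo-informed s38, s41).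
-/

noncomputable section

open MeasureTheory Set Filter
open scoped Classical

namespace Summit.KontsevichZagierPeriods.KontsevichZagierPeriods.Theorems

/-- The rational factor `R(a,b) = m a² [A(b)/D + 2 m a² b² W(b)/D²]`, `A(b) = 1 − 2(1+m)b² + 3mb⁴`,
`W(b) = (1−b²)(1−mb²)`, `D = 1 − m a² b²`, of `∂_b Φ = R κ(a) κ(b)`. [this work] -/
def soloInformedKummerZetaR (m a b : ℝ) : ℝ :=
  m * a ^ 2 * ((1 - 2 * (1 + m) * b ^ 2 + 3 * m * b ^ 4) / (1 - m * a ^ 2 * b ^ 2) +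
    2 * m * a ^ 2 * b ^ 2 * ((1 - b ^ 2) * (1 - m * b ^ 2)) / (1 - m * a ^ 2 * b ^ 2) ^ 2)

/-- The potential `Φ(a,b) = m a² κ(a) · (b W(b)/(1 − m a² b²)) · κ(b)`. [this work] -/
def soloInformedKummerZetaPhi (m a b : ℝ) : ℝ :=
  m * a ^ 2 * ((√(1 - a ^ 2))⁻¹ * (√(1 - m * a ^ 2))⁻¹) *
    (b * ((1 - b ^ 2) * (1 - m * b ^ 2)) / (1 - m * a ^ 2 * b ^ 2)) *
      ((√(1 - b ^ 2))⁻¹ * (√(1 - m * b ^ 2))⁻¹)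

/-! ### Elementary positivity -/

/-- `1 − m ≤ 1 − m a² b²` and `0 < 1 − m a² b²` for `a², b² ≤ 1`, `0 < m < 1`. [folklore] -/
theorem soloInformed_kummerZeta_denom_pos {m a b : ℝ} (hm : m ∈ Ioo (0:ℝ) 1) (ha : a ^ 2 ≤ 1)
    (hb : b ^ 2 ≤ 1) : 1 - m ≤ 1 - m * a ^ 2 * b ^ 2 ∧ 0 < 1 - m * a ^ 2 * b ^ 2 := by
  have h1 : a ^ 2 * b ^ 2 ≤ 1 := by
    calc a ^ 2 * b ^ 2 ≤ 1 * 1 := mul_le_mul ha hb (sq_nonneg _) zero_le_one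
      _ = 1 := one_mul 1
  have h2 : m * (a ^ 2 * b ^ 2) ≤ m * 1 := mul_le_mul_of_nonneg_left h1 hm.1.le
  have h3 : m * a ^ 2 * b ^ 2 = m * (a ^ 2 * b ^ 2) := by ring
  rw [h3]
  constructor <;> linarith [hm.2]

/-- `0 < 1 − b²` and `0 < 1 − m b²` for `b² < 1`, `0 < m < 1`. [folklore] -/
theorem soloInformed_kummerZeta_radicands_pos {m b : ℝ} (hm : m ∈ Ioo (0:ℝ) 1) (hb : b ^ 2 < 1) :
    0 < 1 - b ^ 2 ∧ 0 < 1 - m * b ^ 2 := by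
  refine ⟨by linarith, ?_⟩
  have : m * b ^ 2 ≤ 1 * b ^ 2 := mul_le_mul_of_nonneg_right hm.2.le (sq_nonneg b)
  linarith

/-! ### The rational identity and the certificate -/

/-- **`R(a,b) − R(b,a) = m(a² − b²)`** (exact; `work/s41/cert_xxviii_a_xt.py`). [this work] -/
theorem soloInformed_kummerZeta_rational_identity {m a b : ℝ} (hD : 1 - m * a ^ 2 * b ^ 2 ≠ 0) :
    soloInformedKummerZetaR m a b - soloInformedKummerZetaR m b a = m * (a ^ 2 - b ^ 2) := by
  have hD' : 1 - m * b ^ 2 * a ^ 2 = 1 - m * a ^ 2 * b ^ 2 := by ring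
  simp only [soloInformedKummerZetaR, hD']
  field_simp
  ring

/-- **The certificate (Gauss–Manin along the Kummer family, hyperbolic band).**
`R(x,t)κ(x)κ(t) − R(t,x)κ(t)κ(x) = κ(x)·e(t) − e(x)·κ(t)`, `e(z) = (1 − mz²)κ(z)`. [this work] -/
theorem soloInformed_kummerZeta_certificate {m x t : ℝ} (hD : 1 - m * x ^ 2 * t ^ 2 ≠ 0) :
    soloInformedKummerZetaR m x t * ((√(1 - x ^ 2))⁻¹ * (√(1 - m * x ^ 2))⁻¹) *
        ((√(1 - t ^ 2))⁻¹ * (√(1 - m * t ^ 2))⁻¹) -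
      soloInformedKummerZetaR m t x * ((√(1 - t ^ 2))⁻¹ * (√(1 - m * t ^ 2))⁻¹) *
        ((√(1 - x ^ 2))⁻¹ * (√(1 - m * x ^ 2))⁻¹) =
    ((√(1 - x ^ 2))⁻¹ * (√(1 - m * x ^ 2))⁻¹) *
        ((1 - m * t ^ 2) * ((√(1 - t ^ 2))⁻¹ * (√(1 - m * t ^ 2))⁻¹)) -
      (1 - m * x ^ 2) * ((√(1 - x ^ 2))⁻¹ * (√(1 - m * x ^ 2))⁻¹) *
        ((√(1 - t ^ 2))⁻¹ * (√(1 - m * t ^ 2))⁻¹) := by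
  have h := soloInformed_kummerZeta_rational_identity (m := m) (a := x) (b := t) hD
  linear_combination ((√(1 - x ^ 2))⁻¹ * (√(1 - m * x ^ 2))⁻¹) *
    ((√(1 - t ^ 2))⁻¹ * (√(1 - m * t ^ 2))⁻¹) * h

/-! ### The derivative of the potential -/

/-- `∂_b κ(b) = (b/(1−b²) + mb/(1−mb²))·κ(b)` for `b² < 1`. [folklore] -/
theorem soloInformed_kummerZeta_kappa_hasDerivAt {m b : ℝ} (hm : m ∈ Ioo (0:ℝ) 1)
    (hb : b ^ 2 < 1) :
    HasDerivAt (fun b : ℝ => (√(1 - b ^ 2))⁻¹ * (√(1 - m * b ^ 2))⁻¹)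
      ((b / (1 - b ^ 2) + m * b / (1 - m * b ^ 2)) *
        ((√(1 - b ^ 2))⁻¹ * (√(1 - m * b ^ 2))⁻¹)) b := by
  obtain ⟨h1b, hmb⟩ := soloInformed_kummerZeta_radicands_pos hm hb
  have hA : HasDerivAt (fun b : ℝ => (√(1 - b ^ 2))⁻¹) ((b / (1 - b ^ 2)) * (√(1 - b ^ 2))⁻¹) b :=
    soloInformed_hasDerivAt_inv_sqrt ((soloInformed_hasDerivAt_sq b).const_sub 1) h1b _
      (by rw [mul_left_comm, div_mul_cancel₀ _ h1b.ne']; ring)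
  have hB : HasDerivAt (fun b : ℝ => (√(1 - m * b ^ 2))⁻¹)
      ((m * b / (1 - m * b ^ 2)) * (√(1 - m * b ^ 2))⁻¹) b :=
    soloInformed_hasDerivAt_inv_sqrt (((soloInformed_hasDerivAt_sq b).const_mul m).const_sub 1)
      hmb _ (by rw [mul_left_comm, div_mul_cancel₀ _ hmb.ne']; ring)
  refine (hA.mul hB).congr_deriv ?_
  ring

/-- **`∂_b Φ(a,b) = R(a,b) κ(a) κ(b)`** for `a² ≤ 1`, `b² < 1`, `0 < m < 1`. [this work] -/
theorem soloInformed_kummerZetaPhi_hasDerivAt {m a b : ℝ} (hm : m ∈ Ioo (0:ℝ) 1) (ha : a ^ 2 ≤ 1)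
    (hb : b ^ 2 < 1) :
    HasDerivAt (fun b : ℝ => soloInformedKummerZetaPhi m a b)
      (soloInformedKummerZetaR m a b * ((√(1 - a ^ 2))⁻¹ * (√(1 - m * a ^ 2))⁻¹) *
        ((√(1 - b ^ 2))⁻¹ * (√(1 - m * b ^ 2))⁻¹)) b := by
  obtain ⟨h1b, hmb⟩ := soloInformed_kummerZeta_radicands_pos hm hb
  have hD := (soloInformed_kummerZeta_denom_pos hm ha hb.le).2
  have hs1 : √(1 - b ^ 2) ≠ 0 := (Real.sqrt_pos.2 h1b).ne'
  have hs2 : √(1 - m * b ^ 2) ≠ 0 := (Real.sqrt_pos.2 hmb).ne'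
  -- the rational factor `q(b) = b W(b)/D`
  have hW : HasDerivAt (fun b : ℝ => b * ((1 - b ^ 2) * (1 - m * b ^ 2)))
      (1 * ((1 - b ^ 2) * (1 - m * b ^ 2)) +
        b * (-(2 * b) * (1 - m * b ^ 2) + (1 - b ^ 2) * (-(m * (2 * b))))) b :=
    (hasDerivAt_id' b).mul (((soloInformed_hasDerivAt_sq b).const_sub 1).mul
      (((soloInformed_hasDerivAt_sq b).const_mul m).const_sub 1))
  have hDd : HasDerivAt (fun b : ℝ => 1 - m * a ^ 2 * b ^ 2) (-(m * a ^ 2 * (2 * b))) b :=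
    ((soloInformed_hasDerivAt_sq b).const_mul (m * a ^ 2)).const_sub 1
  have hq : HasDerivAt (fun b : ℝ => b * ((1 - b ^ 2) * (1 - m * b ^ 2)) / (1 - m * a ^ 2 * b ^ 2))
      (((1 * ((1 - b ^ 2) * (1 - m * b ^ 2)) +
          b * (-(2 * b) * (1 - m * b ^ 2) + (1 - b ^ 2) * (-(m * (2 * b))))) *
            (1 - m * a ^ 2 * b ^ 2) -
          b * ((1 - b ^ 2) * (1 - m * b ^ 2)) * (-(m * a ^ 2 * (2 * b)))) /
        (1 - m * a ^ 2 * b ^ 2) ^ 2) b :=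
    hW.div hDd hD.ne'
  have hκ := soloInformed_kummerZeta_kappa_hasDerivAt hm hb
  have key : HasDerivAt (fun b : ℝ => m * a ^ 2 * ((√(1 - a ^ 2))⁻¹ * (√(1 - m * a ^ 2))⁻¹) *
      (b * ((1 - b ^ 2) * (1 - m * b ^ 2)) / (1 - m * a ^ 2 * b ^ 2)) *
        ((√(1 - b ^ 2))⁻¹ * (√(1 - m * b ^ 2))⁻¹)) _ b :=
    (hq.const_mul (m * a ^ 2 * ((√(1 - a ^ 2))⁻¹ * (√(1 - m * a ^ 2))⁻¹))).mul hκ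
  have h1b' : 1 - b ^ 2 ≠ 0 := h1b.ne'
  have hmb' : 1 - m * b ^ 2 ≠ 0 := hmb.ne'
  have hD0 : 1 - m * a ^ 2 * b ^ 2 ≠ 0 := hD.ne'
  unfold soloInformedKummerZetaPhi
  refine key.congr_deriv ?_
  simp only [soloInformedKummerZetaR]
  field_simp
  ring

/-! ### The potential: closed form with square roots, continuity, boundary values -/

/-- `Φ(a,b) = m a² κ(a) · b √(1−b²) √(1−mb²)/(1 − m a² b²)` (`x/√x = √x`). [this work] -/
theorem soloInformed_kummerZetaPhi_eq_sqrt (m a b : ℝ) :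
    soloInformedKummerZetaPhi m a b =
      m * a ^ 2 * ((√(1 - a ^ 2))⁻¹ * (√(1 - m * a ^ 2))⁻¹) *
        (b * (√(1 - b ^ 2) * √(1 - m * b ^ 2)) / (1 - m * a ^ 2 * b ^ 2)) := by
  have h1 : (1 - b ^ 2) * (√(1 - b ^ 2))⁻¹ = √(1 - b ^ 2) := by
    rw [← div_eq_mul_inv, Real.div_sqrt]
  have h2 : (1 - m * b ^ 2) * (√(1 - m * b ^ 2))⁻¹ = √(1 - m * b ^ 2) := by
    rw [← div_eq_mul_inv, Real.div_sqrt]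
  have h3 : (1 - b ^ 2) * (1 - m * b ^ 2) * ((√(1 - b ^ 2))⁻¹ * (√(1 - m * b ^ 2))⁻¹) =
      √(1 - b ^ 2) * √(1 - m * b ^ 2) := by
    calc (1 - b ^ 2) * (1 - m * b ^ 2) * ((√(1 - b ^ 2))⁻¹ * (√(1 - m * b ^ 2))⁻¹)
        = ((1 - b ^ 2) * (√(1 - b ^ 2))⁻¹) * ((1 - m * b ^ 2) * (√(1 - m * b ^ 2))⁻¹) := by ring
      _ = √(1 - b ^ 2) * √(1 - m * b ^ 2) := by rw [h1, h2]
  unfold soloInformedKummerZetaPhi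
  rw [← h3]
  ring

/-- `Φ(a,·)` is continuous on `[0,1]` (`a² ≤ 1`, `0 < m < 1`). [this work] -/
theorem soloInformed_kummerZetaPhi_continuousOn {m a : ℝ} (hm : m ∈ Ioo (0:ℝ) 1) (ha : a ^ 2 ≤ 1) :
    ContinuousOn (fun b : ℝ => soloInformedKummerZetaPhi m a b) (Icc 0 1) := by
  have hfun : (fun b : ℝ => soloInformedKummerZetaPhi m a b) = fun b : ℝ =>
      m * a ^ 2 * ((√(1 - a ^ 2))⁻¹ * (√(1 - m * a ^ 2))⁻¹) *
        (b * (√(1 - b ^ 2) * √(1 - m * b ^ 2)) / (1 - m * a ^ 2 * b ^ 2)) :=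
    funext fun b => soloInformed_kummerZetaPhi_eq_sqrt m a b
  rw [hfun]
  have hc1 : Continuous fun b : ℝ => √(1 - b ^ 2) :=
    Real.continuous_sqrt.comp (continuous_const.sub (continuous_pow 2))
  have hc2 : Continuous fun b : ℝ => √(1 - m * b ^ 2) :=
    Real.continuous_sqrt.comp (continuous_const.sub (continuous_const.mul (continuous_pow 2)))
  have hnum : Continuous fun b : ℝ => b * (√(1 - b ^ 2) * √(1 - m * b ^ 2)) :=
    continuous_id.mul (hc1.mul hc2)
  have hden : Continuous fun b : ℝ => 1 - m * a ^ 2 * b ^ 2 :=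
    continuous_const.sub (continuous_const.mul (continuous_pow 2))
  refine continuousOn_const.mul (hnum.continuousOn.div hden.continuousOn fun b hb => ?_)
  have hb2 : b ^ 2 ≤ 1 := by
    have : b ^ 2 ≤ 1 ^ 2 := pow_le_pow_left₀ hb.1 hb.2 2
    simpa using this
  exact (soloInformed_kummerZeta_denom_pos hm ha hb2).2.ne'

/-- `Φ(a,0) = 0`. [this work] -/
theorem soloInformed_kummerZetaPhi_right_zero (m a : ℝ) : soloInformedKummerZetaPhi m a 0 = 0 := by
  simp [soloInformedKummerZetaPhi]

/-- `Φ(a,1) = 0`. [this work] -/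
theorem soloInformed_kummerZetaPhi_right_one (m a : ℝ) : soloInformedKummerZetaPhi m a 1 = 0 := by
  simp [soloInformedKummerZetaPhi]

/-- **The deformed end.**  `Φ(x,σ) = (σ⁻¹W(σ)κ(σ)) · ((1 − nx²)⁻¹ − 1) · κ(x)` with `n = mσ²`
(`σ⁻¹W(σ)κ(σ) = w(σ)/σ = δ₁⁻¹`): the integrand of `⟦[pt, w(σ)/σ]⟧·(⟦Π_n⟧ − ⟦K⟧)`, since
`(1−nx²)⁻¹ − 1 = nx²/(1−nx²)`. [this work] -/
theorem soloInformed_kummerZetaPhi_end {m x σ : ℝ} (hσ : σ ≠ 0) (hD : 1 - m * σ ^ 2 * x ^ 2 ≠ 0) :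
    soloInformedKummerZetaPhi m x σ =
      σ⁻¹ * ((1 - σ ^ 2) * (1 - m * σ ^ 2)) * ((√(1 - σ ^ 2))⁻¹ * (√(1 - m * σ ^ 2))⁻¹) *
        (((1 - m * σ ^ 2 * x ^ 2)⁻¹ - 1) * ((√(1 - x ^ 2))⁻¹ * (√(1 - m * x ^ 2))⁻¹)) := by
  have hD' : 1 - m * x ^ 2 * σ ^ 2 = 1 - m * σ ^ 2 * x ^ 2 := by ring
  have hfrac : (1 - m * σ ^ 2 * x ^ 2)⁻¹ - 1 =
      m * σ ^ 2 * x ^ 2 * (1 - m * σ ^ 2 * x ^ 2)⁻¹ := by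
    linear_combination mul_inv_cancel₀ hD
  have hσ2 : σ⁻¹ * σ ^ 2 = σ := by rw [pow_two, ← mul_assoc, inv_mul_cancel₀ hσ, one_mul]
  unfold soloInformedKummerZetaPhi
  rw [hD', hfrac, div_eq_mul_inv]
  linear_combination (-(m * x ^ 2 * ((√(1 - x ^ 2))⁻¹ * (√(1 - m * x ^ 2))⁻¹) *
    ((√(1 - σ ^ 2))⁻¹ * (√(1 - m * σ ^ 2))⁻¹) * ((1 - σ ^ 2) * (1 - m * σ ^ 2)) *
      (1 - m * σ ^ 2 * x ^ 2)⁻¹)) * hσ2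

/-! ### Bounds -/

/-- `|R(a,b)| ≤ 6/(1−m)²` for `a², b² ≤ 1`, `0 < m < 1`. [this work] -/
theorem soloInformed_kummerZeta_abs_R_le {m a b : ℝ} (hm : m ∈ Ioo (0:ℝ) 1) (ha : a ^ 2 ≤ 1)
    (hb : b ^ 2 ≤ 1) : |soloInformedKummerZetaR m a b| ≤ 6 / (1 - m) ^ 2 := by
  obtain ⟨hDm, hD⟩ := soloInformed_kummerZeta_denom_pos hm ha hb
  have ha0 : 0 ≤ a ^ 2 := sq_nonneg a
  have hb0 : 0 ≤ b ^ 2 := sq_nonneg b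
  have hb4 : b ^ 4 = b ^ 2 * b ^ 2 := by ring
  -- numerator / D²
  have hR : soloInformedKummerZetaR m a b =
      m * a ^ 2 * ((1 - 2 * (1 + m) * b ^ 2 + 3 * m * b ^ 4) * (1 - m * a ^ 2 * b ^ 2) +
        2 * m * a ^ 2 * b ^ 2 * ((1 - b ^ 2) * (1 - m * b ^ 2))) / (1 - m * a ^ 2 * b ^ 2) ^ 2 := by
    unfold soloInformedKummerZetaR
    field_simp
  have hA : |1 - 2 * (1 + m) * b ^ 2 + 3 * m * b ^ 4| ≤ 4 := by
    rw [abs_le, hb4]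
    constructor <;> nlinarith [hm.1, hm.2, mul_nonneg hb0 hb0, mul_le_mul hb hb hb0 zero_le_one]
  have hDle : |1 - m * a ^ 2 * b ^ 2| ≤ 1 := by
    rw [abs_of_pos hD]
    nlinarith [mul_nonneg (mul_nonneg hm.1.le ha0) hb0]
  have hW0 : 0 ≤ (1 - b ^ 2) * (1 - m * b ^ 2) :=
    mul_nonneg (by linarith) (by nlinarith [hm.2])
  have hW1 : (1 - b ^ 2) * (1 - m * b ^ 2) ≤ 1 := by
    calc (1 - b ^ 2) * (1 - m * b ^ 2) ≤ 1 * 1 :=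
          mul_le_mul (by linarith) (by nlinarith [hm.1]) (by nlinarith [hm.2]) zero_le_one
      _ = 1 := one_mul 1
  have hT2 : |2 * m * a ^ 2 * b ^ 2 * ((1 - b ^ 2) * (1 - m * b ^ 2))| ≤ 2 := by
    have hc : 0 ≤ 2 * m * a ^ 2 * b ^ 2 :=
      mul_nonneg (mul_nonneg (mul_nonneg zero_le_two hm.1.le) ha0) hb0
    have hc1 : 2 * m * a ^ 2 * b ^ 2 ≤ 2 := by
      have : m * a ^ 2 * b ^ 2 ≤ 1 := by linarith
      linarith
    rw [abs_of_nonneg (mul_nonneg hc hW0)]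
    calc 2 * m * a ^ 2 * b ^ 2 * ((1 - b ^ 2) * (1 - m * b ^ 2)) ≤ 2 * 1 :=
          mul_le_mul hc1 hW1 hW0 (by norm_num)
      _ = 2 := by norm_num
  have hnum : |m * a ^ 2 * ((1 - 2 * (1 + m) * b ^ 2 + 3 * m * b ^ 4) * (1 - m * a ^ 2 * b ^ 2) +
      2 * m * a ^ 2 * b ^ 2 * ((1 - b ^ 2) * (1 - m * b ^ 2)))| ≤ 6 := by
    rw [abs_mul]
    have hma : |m * a ^ 2| ≤ 1 := by
      rw [abs_of_nonneg (mul_nonneg hm.1.le ha0)]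
      nlinarith [hm.2]
    have hin : |(1 - 2 * (1 + m) * b ^ 2 + 3 * m * b ^ 4) * (1 - m * a ^ 2 * b ^ 2) +
        2 * m * a ^ 2 * b ^ 2 * ((1 - b ^ 2) * (1 - m * b ^ 2))| ≤ 6 := by
      refine (abs_add_le _ _).trans ?_
      rw [abs_mul]
      have : |1 - 2 * (1 + m) * b ^ 2 + 3 * m * b ^ 4| * |1 - m * a ^ 2 * b ^ 2| ≤ 4 * 1 :=
        mul_le_mul hA hDle (abs_nonneg _) (by norm_num)
      linarith
    calc |m * a ^ 2| * |(1 - 2 * (1 + m) * b ^ 2 + 3 * m * b ^ 4) * (1 - m * a ^ 2 * b ^ 2) +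
          2 * m * a ^ 2 * b ^ 2 * ((1 - b ^ 2) * (1 - m * b ^ 2))| ≤ 1 * 6 :=
          mul_le_mul hma hin (abs_nonneg _) zero_le_one
      _ = 6 := one_mul 6
  have h1m : 0 < 1 - m := by linarith [hm.2]
  rw [hR, abs_div, abs_of_pos (pow_pos hD 2), div_le_div_iff₀ (pow_pos hD 2) (pow_pos h1m 2)]
  have hsq : (1 - m) ^ 2 ≤ (1 - m * a ^ 2 * b ^ 2) ^ 2 := pow_le_pow_left₀ h1m.le hDm 2
  exact mul_le_mul hnum hsq (sq_nonneg _) (by norm_num)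

/-- `κ(z) ≤ (√(1−z))⁻¹ (√(1−m))⁻¹` for `z ∈ [0,1)`, `0 < m < 1`. [folklore] -/
theorem soloInformed_kummerZeta_kappa_le {m z : ℝ} (hm : m ∈ Ioo (0:ℝ) 1) (hz : z ∈ Ico (0:ℝ) 1) :
    (√(1 - z ^ 2))⁻¹ * (√(1 - m * z ^ 2))⁻¹ ≤ (√(1 - z))⁻¹ * (√(1 - m))⁻¹ := by
  have hz2 : z ^ 2 ≤ z := by nlinarith [hz.1, hz.2]
  have h1 : 0 < 1 - z := by linarith [hz.2]
  have h1m : 0 < 1 - m := by linarith [hm.2]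
  have hA : (√(1 - z ^ 2))⁻¹ ≤ (√(1 - z))⁻¹ :=
    inv_anti₀ (Real.sqrt_pos.2 h1) (Real.sqrt_le_sqrt (by linarith))
  have hB : (√(1 - m * z ^ 2))⁻¹ ≤ (√(1 - m))⁻¹ := by
    refine inv_anti₀ (Real.sqrt_pos.2 h1m) (Real.sqrt_le_sqrt ?_)
    have : m * z ^ 2 ≤ m * 1 := mul_le_mul_of_nonneg_left (by nlinarith [hz.1, hz.2]) hm.1.le
    linarith
  exact mul_le_mul hA hB (by positivity) (by positivity)

/-- **Domination.**  `|R(a,b) κ(a) κ(b)| ≤ 6(1−m)⁻³ · (√(1−a))⁻¹ (√(1−b))⁻¹` for `a, b ∈ [0,1)`.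
[this work] -/
theorem soloInformed_kummerZeta_kernel_le {m a b : ℝ} (hm : m ∈ Ioo (0:ℝ) 1) (ha : a ∈ Ico (0:ℝ) 1)
    (hb : b ∈ Ico (0:ℝ) 1) :
    |soloInformedKummerZetaR m a b * ((√(1 - a ^ 2))⁻¹ * (√(1 - m * a ^ 2))⁻¹) *
        ((√(1 - b ^ 2))⁻¹ * (√(1 - m * b ^ 2))⁻¹)| ≤
      6 / (1 - m) ^ 3 * ((√(1 - a))⁻¹ * (√(1 - b))⁻¹) := by
  have ha2 : a ^ 2 ≤ 1 := by nlinarith [ha.1, ha.2]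
  have hb2 : b ^ 2 ≤ 1 := by nlinarith [hb.1, hb.2]
  have h1m : 0 < 1 - m := by linarith [hm.2]
  have hκa : 0 ≤ (√(1 - a ^ 2))⁻¹ * (√(1 - m * a ^ 2))⁻¹ := by positivity
  have hκb : 0 ≤ (√(1 - b ^ 2))⁻¹ * (√(1 - m * b ^ 2))⁻¹ := by positivity
  rw [abs_mul, abs_mul, abs_of_nonneg hκa, abs_of_nonneg hκb]
  have hR := soloInformed_kummerZeta_abs_R_le hm ha2 hb2
  have hA := soloInformed_kummerZeta_kappa_le hm ha
  have hB := soloInformed_kummerZeta_kappa_le hm hb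
  have hmm : (√(1 - m))⁻¹ * (√(1 - m))⁻¹ = (1 - m)⁻¹ := by
    rw [← mul_inv, Real.mul_self_sqrt h1m.le]
  calc |soloInformedKummerZetaR m a b| * ((√(1 - a ^ 2))⁻¹ * (√(1 - m * a ^ 2))⁻¹) *
        ((√(1 - b ^ 2))⁻¹ * (√(1 - m * b ^ 2))⁻¹)
      ≤ 6 / (1 - m) ^ 2 * ((√(1 - a))⁻¹ * (√(1 - m))⁻¹) * ((√(1 - b))⁻¹ * (√(1 - m))⁻¹) := by
        refine mul_le_mul (mul_le_mul hR hA hκa (by positivity)) hB hκb (by positivity)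
    _ = 6 / (1 - m) ^ 2 * ((√(1 - m))⁻¹ * (√(1 - m))⁻¹) * ((√(1 - a))⁻¹ * (√(1 - b))⁻¹) := by
        ring
    _ = 6 / (1 - m) ^ 3 * ((√(1 - a))⁻¹ * (√(1 - b))⁻¹) := by
        rw [hmm]
        field_simp

end Summit.KontsevichZagierPeriods.KontsevichZagierPeriods.Theorems

end
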